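import Summits.SmoothPoincare4.SmoothPoincare4.Theses.TransparentBalls
import HarnessLib

/-!
# Line `birth` — BC3 skeleton for the crux `PuncturedSpheresTransparent` (stmt-SmoothPoincare4-7265)

Route `TransparentBalls` (route-SmoothPoincare4-TransparentBalls), crux #3 `PuncturedSpheresTransparent`
(rank 3, TRANSP_Σ, "open-problem"): every homotopy 4-sphere `Σ` admits a Riemannian metric `g` (with its
Levi-Civita connection), a point `p`, a radius `r` and a smooth `ρ` presenting the PUNCTURE
`D = {ρ ≤ 0} = Σ ∖ E°`, `E = {0 ≤ ρ}` the closed chart ball `(extChartAt p)⁻¹(closedBall r)`, with `0` a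
regular value of `ρ` on `∂D = {ρ = 0}`, `∂D` strictly `g`-convex from `D` (`Hess_g ρ (v,v) > 0` on
`ker dρ`), and `D` NON-TRAPPING (every complete `g`-geodesic starting in `D` with non-zero velocity
reaches `{ρ > 0}` at some positive time).

Skeleton registrar (planner one-shot `skel-stmt-SmoothPoincare4-7265`, 2026-08-17; re-audit bin
REPAIRABLE).  THE LINE — "TRANSP_Σ through its fibre-degree-one rung, WITHOUT the outward
normalisation" — comes from the route header itself (WHY THIS LINE: "escape functions grade transparency
by their degree in the velocity: degree 1 (`f = g(V,γ')`) means an outward g-EXPANDING vector field …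
that rung is provably rigid (support `ExpandingFieldTwisted`)").  PSU Prop. 3.3.1 (non-trapping ⟺ an
escape function `f ∈ C^∞(SD)`, `Xf > 0`) is PROVED in the tree
(`Literature.Geometry.Riemannian.PaternainSaloUhlmann2023_nonTrapping_iff_holds`); the escape function
of this line is the fibre-LINEAR one, `f(x,v) = g_x(V_x, v)` for a vector field `V` with
`½ 𝓛_V g = sym ∇V > 0` on `D` ("`g`-expanding"), because then
`Xf = (d/dt) g(V∘γ, γ̇) = g(∇_γ̇ V, γ̇) > 0` along every geodesic (O'Neill Ch. 9, Lemma 26; tree: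
`PseudoRiemannianMetric.hasDerivAt_val_apply_velocity_of_isGeodesicOn`).  The support item
`ExpandingFieldTwisted` (stmt-7267) shows that an expanding field which moreover points OUTWARD along
`∂D` (`dρ(V) > 0`) makes `Σ` a twisted sphere; the present line drops outwardness (the `−V` flow need
not preserve `D`) and asks only for the boundary convexity the crux wants anyway.  Two named statements:

* `stub_expandingPuncture` — THE BET (open; carries the crux's existential content): every homotopy
  4-sphere admits `g, p, r, ρ` with the crux's first SEVEN clauses verbatim (Riemannian, `ρ` smooth,
  `r > 0`, chart ball inside the chart target, co-ball `{0 ≤ ρ} = chart⁻¹(closedBall r)`, `0` regular on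
  `{ρ = 0}`, `∂D` strictly convex) AND a smooth vector field `V` on `Σ` that is `g`-EXPANDING ON THE
  PUNCTURE: `g_x(∇_w V, w) > 0` for `ρ x ≤ 0`, `w ≠ 0` (the expansion clause of stmt-7267 verbatim; no
  condition on `V` along `∂D`).  True for every `Σ ≅ S⁴` whatever its atlas (Palais' disc theorem makes
  the chart ball `E` ambiently standard, so `D` is a smooth 4-ball; flat metric of `B⁴(R)`, `V = y` the
  position field, `g(∇_w V, w) = |w|²`, round `∂D` convex; extend `g, ρ, V` smoothly over `E`).  For a
  hypothetical exotic `Σ` it asks for an expanding pair `(g, V)` with convex boundary on the exotic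
  puncture — open.  Is it secretly rigid (⇒ `D ≅ B⁴`, i.e. summit-strength like 7267)?  Not by any
  argument the registrar knows: without `dρ(V) > 0` the backward flow leaves `D`; `div V > 0` gives only a
  positive TOTAL flux through `∂D`; monotonicity of `t ↦ g(V, σ̇)` along chords gives at most one zero of
  `V` in `D` but no Morse function.  (CONTRAST, recorded as negative knowledge for ideators: the HESSIAN
  rung — a smooth `u` strictly `g`-convex on `D`, `V = ∇u` — IS rigid: with `∂D` strictly convex every
  inward boundary critical point of `u|∂D` is a non-degenerate minimum, `Hess(u|∂D) = Hess u + λ·II > 0`,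
  so boundary Morse theory builds `D` from index-0 handles only and `D ≅ B⁴`; that rung is SPC4 in convex
  clothing (through Cerf `Γ₄ = 0`) and was rejected for this skeleton.)
* `stub_expandingField_nonTrapping` — THE LEMMA (M, provable now with the tree's toolkit): on a closed
  smooth Riemannian 4-manifold `M`, if a smooth vector field `V` is `g`-expanding at every point of the
  compact sublevel domain `D = {ρ ≤ 0}` (`ρ` smooth), then `D` traps no geodesic.  Printed proof shape
  (PSU Prop. 3.3.1 (iii) ⇒ (i), p. 67, with `f = g(V, v)`): along a geodesic `γ` with `γ(t) ∈ D` for all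
  `t ≥ 0` and speed `c = |γ̇| > 0` (constant, `IsGeodesic.val_velocity_eq`), `F(t) = g(V(γ t), γ̇(t))` has
  `F' = g(∇_γ̇ V, γ̇) ≥ ε c²` with `ε > 0` the minimum of the continuous positive function
  `(x,w) ↦ g(∇_w V, w)` on the compact unit sphere bundle over `D` (`isCompact_unitTangent`), while
  `|F| ≤ c · max_D |V|` — contradiction.  Equivalently `f(x,v) = g(V_x, v)` is an escape function on
  `S D` and the PROVED `HasEscapeFunction.isNonTrappingSublevel` applies.  No convexity of `∂D`, no
  boundary condition on `V`, no connectedness is needed.  It is also the "automatically non-trapping"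
  sentence of stmt-7267's docstring, made a statement.

Composition (`puncturedSpheresTransparent_of_stubSigs`, sorry-free, axioms propext / Classical.choice /
Quot.sound; `PuncturedSpheresTransparent_of` feeds it the two stubs and concludes the crux BY NAME): for
`S`, take `(g, p, r, ρ, V)` from stub 1; clauses 1–7 of the crux are clauses 1–7 of the stub; clause 8
(non-trapping) is stub 2 at `M = S.carrier` (compact, Hausdorff, second countable: the `HomotopySphere`
instances) applied to `V`.

Honest sizes: stub 1 = the crux's open content in degree-one (expanding-field) form; stub 2 M.  `sorry`
occurs ONLY in the two `stub_*` theorems.  Disproof used: none — `Cruxes/PuncturedSpheresTransparent/`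
had no workfiles at registration (`ledger crux ls`), and `ledger negatives --problem SmoothPoincare4`
lists 0 refuted statements (2026-08-17), so no stub is an instance of a refuted statement.  Typing
checklist 4c: no thresholds, integrals, determinantal or partition-function content; `g.leviCivita V x w`
and `g.hessian ρ x v v` are used exactly as in the route's own items 7267 / 7265 (smooth data, non-junk).
-/

noncomputable section

-- `Summit.<Summit>.<Problem>`: for the single-conjunct summit the duplicate component is mandated.
set_option linter.dupNamespace false
set_option linter.unusedVariables false

open scoped Manifold ContDiff Topology

namespace Summit.SmoothPoincare4.SmoothPoincare4.Cruxes.PuncturedSpheresTransparent.Birth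

/-! ## The two registered stubs -/

/-- **Stub 1 — a convex-boundary puncture carrying a `g`-expanding vector field (THE BET of the line).**
Every homotopy 4-sphere `Σ` admits a Riemannian metric `g` with Levi-Civita connection, a point `p`, a
radius `r > 0` with `closedBall (chart p p) r ⊆ chart target`, and a smooth `ρ` with
`{0 ≤ ρ} = chart⁻¹(closedBall r)` (so `D = {ρ ≤ 0}` is `Σ` minus an open chart ball), `dρ ≠ 0` on
`{ρ = 0}` and `∂D` strictly `g`-convex from `D` — the crux's clauses 1–7 verbatim — together with a smooth
vector field `V` on `Σ` that is `g`-EXPANDING at every point of `D`: `g_x(∇_w V, w) > 0` for `ρ x ≤ 0`,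
`w ≠ 0` (the expansion clause of `ExpandingFieldTwisted`, stmt-7267, WITHOUT its outward clause
`dρ(V) > 0` on `∂D`).
Why plausibly true / why it might fail: true for every `Σ ≅ S⁴` whatever its atlas (Palais: the chart ball
is ambiently standard, `D` a smooth ball; flat metric, `V` the position field); for a hypothetical exotic
`Σ` it asks for an expanding metric/vector-field pair with convex boundary on the exotic puncture — open,
and possibly as strong as `D ≅ B⁴` should expanding punctures turn out to be rigid even without
outwardness (7267 needs `dρ(V) > 0`; the Hessian rung `V = ∇u`, `u` convex, is rigid by boundary Morse
theory and is deliberately NOT what is asked here).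
Size: open (the crux's existential content, degree-one rung).  Sources: PaternainSaloUhlmann2023
(Prop. 3.3.1, Lemma 3.1.12, Example 3.1.4), ONeill1983 (Ch. 9, Lemma 26), Kirby1997 (Problem 4.89),
Cerf1968, Milnor1965 (disc theorem; Palais 1960), KervaireMilnor1963. -/
theorem stub_expandingPuncture :
    ∀ S : Literature.Topology.FourManifolds.HomotopySphere 4,
    ∃ (g : Literature.Geometry.Lorentzian.PseudoRiemannianMetric (𝓡 4) ∞ (EuclideanSpace ℝ (Fin 4)) (TangentSpace (𝓡 4) : S.carrier → Type _))
    (_ : g.HasLeviCivita) (p : S.carrier) (r : ℝ) (ρ : S.carrier → ℝ)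
    (V : Π x : S.carrier, TangentSpace (𝓡 4) x),
    g.IsRiemannian ∧ ContMDiff (𝓡 4) 𝓘(ℝ, ℝ) ∞ ρ ∧ 0 < r ∧
    Metric.closedBall (extChartAt (𝓡 4) p p) r ⊆ (extChartAt (𝓡 4) p).target ∧
    {x | 0 ≤ ρ x} = (extChartAt (𝓡 4) p).symm '' Metric.closedBall (extChartAt (𝓡 4) p p) r ∧
    (∀ x, ρ x = 0 → mfderiv (𝓡 4) 𝓘(ℝ, ℝ) ρ x ≠ 0) ∧
    (∀ x, ρ x = 0 → ∀ v : TangentSpace (𝓡 4) x, v ≠ 0 → mfderiv (𝓡 4) 𝓘(ℝ, ℝ) ρ x v = 0 →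
      0 < g.hessian ρ x v v) ∧
    ContMDiff (𝓡 4) (𝓡 4).tangent ∞ (T% V) ∧
    (∀ x, ρ x ≤ 0 → ∀ w : TangentSpace (𝓡 4) x, w ≠ 0 → 0 < g.val x (g.leviCivita V x w) w) := by
  sorry

/-- **Stub 2 — a `g`-expanding vector field on a compact sublevel domain forces every geodesic out
(THE LEMMA; PSU Prop. 3.3.1 (iii) ⇒ (i) with the fibre-linear escape function `f = g(V, v)`).**
On a closed (compact, Hausdorff, second countable) smooth Riemannian 4-manifold `M` with Levi-Civita
connection, let `ρ` be smooth and `V` a smooth vector field with `g_x(∇_w V, w) > 0` for all `x` with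
`ρ x ≤ 0` and `w ≠ 0`.  Then every complete geodesic `γ` of `g` with `ρ (γ 0) ≤ 0` and `γ̇(0) ≠ 0`
satisfies `ρ (γ t) > 0` for some `t > 0`.  Proof sketch: were `ρ ∘ γ ≤ 0` on `(0, ∞)`, then
`F(t) = g(V(γ t), γ̇(t))` would have `F' = g(∇_γ̇ V, γ̇) ≥ ε |γ̇(0)|² > 0` on `[0, ∞)` (constant speed;
`ε` = minimum of the continuous positive `(x,w) ↦ g(∇_w V, w)` over the compact unit sphere bundle of
`D = {ρ ≤ 0}`), so `F → +∞`, while `|F| ≤ |γ̇| · max_D |V|_g`.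
Why plausibly true: it is the printed argument of PSU p. 67 for the particular escape function
`g(V, v)`; all ingredients are in the tree (`IsGeodesic.val_velocity_eq`,
`PseudoRiemannianMetric.hasDerivAt_val_apply_velocity_of_isGeodesicOn`, `isCompact_unitTangent`,
`exists_unitSpeed_of_trapped`, or directly `HasEscapeFunction.isNonTrappingSublevel` with
`f p = g.val p.proj (V p.proj) p.snd`).
Size: M.  Sources: PaternainSaloUhlmann2023 (Prop. 3.3.1), ONeill1983 (Ch. 9, Lemma 26, p. 252). -/
theorem stub_expandingField_nonTrapping :
    ∀ (M : Type) [TopologicalSpace M] [T2Space M] [SecondCountableTopology M] [CompactSpace M]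
    [ChartedSpace (EuclideanSpace ℝ (Fin 4)) M] [IsManifold (𝓡 4) ∞ M]
    (g : Literature.Geometry.Lorentzian.PseudoRiemannianMetric (𝓡 4) ∞ (EuclideanSpace ℝ (Fin 4)) (TangentSpace (𝓡 4) : M → Type _))
    [g.HasLeviCivita] (ρ : M → ℝ) (V : Π x : M, TangentSpace (𝓡 4) x),
    g.IsRiemannian → ContMDiff (𝓡 4) 𝓘(ℝ, ℝ) ∞ ρ → ContMDiff (𝓡 4) (𝓡 4).tangent ∞ (T% V) →
    (∀ x, ρ x ≤ 0 → ∀ w : TangentSpace (𝓡 4) x, w ≠ 0 → 0 < g.val x (g.leviCivita V x w) w) →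
    ∀ γ : ℝ → M, Literature.Geometry.Lorentzian.IsGeodesic g.leviCivita γ → ρ (γ 0) ≤ 0 →
    Literature.Geometry.Lorentzian.velocity (𝓡 4) γ 0 ≠ 0 → ∃ t : ℝ, 0 < t ∧ 0 < ρ (γ t) := by
  sorry

/-! ## The composition (sorry-free): the two statements imply the crux -/

/-- **The two stub statements imply `PuncturedSpheresTransparent`, pointwise in the homotopy sphere** —
the real assembly of the line (pure logic: clauses 1–7 are carried over, clause 8 is stub 2 at
`M = S.carrier` applied to the expanding field `V`).  The conclusion is the crux's body for the given
`S`, verbatim. [folklore] -/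
theorem puncturedSpheresTransparent_of_stubSigs
    (h1 : ∀ S : Literature.Topology.FourManifolds.HomotopySphere 4,
      ∃ (g : Literature.Geometry.Lorentzian.PseudoRiemannianMetric (𝓡 4) ∞ (EuclideanSpace ℝ (Fin 4)) (TangentSpace (𝓡 4) : S.carrier → Type _))
      (_ : g.HasLeviCivita) (p : S.carrier) (r : ℝ) (ρ : S.carrier → ℝ)
      (V : Π x : S.carrier, TangentSpace (𝓡 4) x),
      g.IsRiemannian ∧ ContMDiff (𝓡 4) 𝓘(ℝ, ℝ) ∞ ρ ∧ 0 < r ∧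
      Metric.closedBall (extChartAt (𝓡 4) p p) r ⊆ (extChartAt (𝓡 4) p).target ∧
      {x | 0 ≤ ρ x} = (extChartAt (𝓡 4) p).symm '' Metric.closedBall (extChartAt (𝓡 4) p p) r ∧
      (∀ x, ρ x = 0 → mfderiv (𝓡 4) 𝓘(ℝ, ℝ) ρ x ≠ 0) ∧
      (∀ x, ρ x = 0 → ∀ v : TangentSpace (𝓡 4) x, v ≠ 0 → mfderiv (𝓡 4) 𝓘(ℝ, ℝ) ρ x v = 0 →
        0 < g.hessian ρ x v v) ∧
      ContMDiff (𝓡 4) (𝓡 4).tangent ∞ (T% V) ∧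
      (∀ x, ρ x ≤ 0 → ∀ w : TangentSpace (𝓡 4) x, w ≠ 0 → 0 < g.val x (g.leviCivita V x w) w))
    (h2 : ∀ (M : Type) [TopologicalSpace M] [T2Space M] [SecondCountableTopology M] [CompactSpace M]
      [ChartedSpace (EuclideanSpace ℝ (Fin 4)) M] [IsManifold (𝓡 4) ∞ M]
      (g : Literature.Geometry.Lorentzian.PseudoRiemannianMetric (𝓡 4) ∞ (EuclideanSpace ℝ (Fin 4)) (TangentSpace (𝓡 4) : M → Type _))
      [g.HasLeviCivita] (ρ : M → ℝ) (V : Π x : M, TangentSpace (𝓡 4) x),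
      g.IsRiemannian → ContMDiff (𝓡 4) 𝓘(ℝ, ℝ) ∞ ρ → ContMDiff (𝓡 4) (𝓡 4).tangent ∞ (T% V) →
      (∀ x, ρ x ≤ 0 → ∀ w : TangentSpace (𝓡 4) x, w ≠ 0 → 0 < g.val x (g.leviCivita V x w) w) →
      ∀ γ : ℝ → M, Literature.Geometry.Lorentzian.IsGeodesic g.leviCivita γ → ρ (γ 0) ≤ 0 →
      Literature.Geometry.Lorentzian.velocity (𝓡 4) γ 0 ≠ 0 → ∃ t : ℝ, 0 < t ∧ 0 < ρ (γ t))
    (S : Literature.Topology.FourManifolds.HomotopySphere 4) :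
    ∃ (g : Literature.Geometry.Lorentzian.PseudoRiemannianMetric (𝓡 4) ∞ (EuclideanSpace ℝ (Fin 4))
      (TangentSpace (𝓡 4) : S.carrier → Type _)) (_ : g.HasLeviCivita) (p : S.carrier) (r : ℝ)
      (ρ : S.carrier → ℝ), g.IsRiemannian ∧ ContMDiff (𝓡 4) 𝓘(ℝ, ℝ) ∞ ρ ∧ 0 < r ∧
      Metric.closedBall (extChartAt (𝓡 4) p p) r ⊆ (extChartAt (𝓡 4) p).target ∧
      {x | 0 ≤ ρ x} = (extChartAt (𝓡 4) p).symm '' Metric.closedBall (extChartAt (𝓡 4) p p) r ∧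
      (∀ x, ρ x = 0 → mfderiv (𝓡 4) 𝓘(ℝ, ℝ) ρ x ≠ 0) ∧
      (∀ x, ρ x = 0 → ∀ v : TangentSpace (𝓡 4) x, v ≠ 0 → mfderiv (𝓡 4) 𝓘(ℝ, ℝ) ρ x v = 0 →
        0 < g.hessian ρ x v v) ∧
      (∀ γ : ℝ → S.carrier, Literature.Geometry.Lorentzian.IsGeodesic g.leviCivita γ → ρ (γ 0) ≤ 0 →
        Literature.Geometry.Lorentzian.velocity (𝓡 4) γ 0 ≠ 0 → ∃ t : ℝ, 0 < t ∧ 0 < ρ (γ t)) := by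
  -- stub 1: the convex-boundary puncture `(g, p, r, ρ)` with a `g`-expanding field `V` on it
  obtain ⟨g, hLC, p, r, ρ, V, hg, hρ, hr, hsub, hco, hreg, hconv, hV, hexp⟩ := h1 S
  haveI := hLC
  -- clauses 1–7 verbatim; clause 8 from stub 2 at `M = S.carrier`
  exact ⟨g, hLC, p, r, ρ, hg, hρ, hr, hsub, hco, hreg, hconv, h2 S.carrier g ρ V hg hρ hV hexp⟩

/-- **THE SKELETON THEOREM: `TransparentBalls.PuncturedSpheresTransparent` BY NAME from the two declared
stubs** (`ledger skeleton check` shape: no hypotheses; `sorry` enters only through `stub_*`). [folklore] -/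
theorem PuncturedSpheresTransparent_of :
    Summit.SmoothPoincare4.SmoothPoincare4.Theses.TransparentBalls.PuncturedSpheresTransparent := by
  intro S
  exact puncturedSpheresTransparent_of_stubSigs stub_expandingPuncture
    stub_expandingField_nonTrapping S

end Summit.SmoothPoincare4.SmoothPoincare4.Cruxes.PuncturedSpheresTransparent.Birth

end
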